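import Summits.CriticalPhenomena.PercolationContinuityZ3.Theorems.PercNearOneGluingNoHeavyLowerTailKnQuestion8AntitheticHat
import HarnessLib

/-!
# `NoHeavyLowerTail` (crux stmt-CriticalPhenomena-4575), antithetic vdBHK programme: ROOT INSERTION AT ANY ATOM (THEOREM S2ᵤ of FINDING-S2U-g55.md) —
# the two dictionary lemmas at the colouring level: the diagonal is a copy of `TQ` (LEMMA Aᵤ) and on the antidiagonal the colouring order is
# 'live order × dead chains' (LEMMA Dᵤ, order part)

Support file (seat `prim-ineq-gen-7` gen 55; `--supports stmt-CriticalPhenomena-4575`).  No `sorry`, no definitions.  Companion of `AntitheticHat`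
(the case `Y = ∅`).  Memo: run/shared/lean/prim/prim-ineq-gen-7/FINDING-S2U-g55.md §1.

SETTING (hypothesis style of `AntitheticHat`).  `E` is the ground set of `Q ∪ₐ wedge`, `down e` the strict down-sets, `u` an atom (`↓°u = ∅`), and `dead e`
marks the elements of `↑Y` for a set `Y` of covers of `u`: `u` lies below every dead element (`hdu`) and `dead` is up-closed (`hdup`).  The new element
`z = none : Option E` is INSERTED between `u` and `Y`: `↓°z = {u}` (`hdZn`), `↓°(some e) = some″↓°e` plus `z` exactly when `e` is dead (`hdZs`).  `leT`, `leZ` are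
the explicit colouring orders (`hleT`, `hleZ`, as in `AntitheticHat`).  (`Y = ∅`: no dead element, the hat; `Y = Cov(u)`: the stalk of FINDING-STALK-g54.)
* `AntitheticInsertion.diag_iff_ins` — **LEMMA Aᵤ**: for colourings `t, t′` of `Q^{u,Y} ∪ₐ wedge` with `z` coloured like `u`, `leZ t t′ ↔ leT (t∘some) (t′∘some)`:
  the diagonal `{z ≡ u}` with the induced order is `TQ`.
* `AntitheticInsertion.off_iff_ins` — **LEMMA Dᵤ (order part)**: for `t, t′` with `z` coloured unlike `u`, `leZ t t′` holds iff the three order conditions hold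
  at every LIVE element for the restrictions to `Q` AND every dead element that is red in `t` is red in `t′` (dead elements form free chains blue < red): the
  antidiagonal is the product `T(Q∖↑Y) × (blue<red)^{↑Y}` as an ordered set (the bijection with the product and the compatibility of the wedge flip are
  immediate; FINDING-S2U-g55 §1b; machine-exact on 436 + 3,034 rooted bases).
With `AntitheticStalkSplit.R_split`/`R_diag_eq`, `AntitheticWedgeProduct.product_R` (THEOREM R₀), Kleitman for cubes and `AntitheticHat.hat_lift` (descent to
the down-set `Q∖↑Y`) these are the two colouring-level inputs of THEOREM S2ᵤ(i): `(R)(Q,a) ⟹ (R)(Q^{u,Y},a)` for every atom `u` and every `Y ⊆ Cov(u)`.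
-/

namespace Summit.CriticalPhenomena.PercolationContinuityZ3.Theorems

open Finset

namespace AntitheticInsertion

variable {E : Type*}

/-- Bounded quantifier over `↓°(some e) = some″↓°e ∪ {z | e dead}`. [this work] -/
theorem forall_downZ_some_ins (down : E → Finset E) (dead : E → Prop) (downZ : Option E → Finset (Option E))
    (hdZs : ∀ e o, o ∈ downZ (some e) ↔ (∃ d ∈ down e, o = some d) ∨ (o = none ∧ dead e)) (P : Option E → Prop) (e : E) :
    (∀ o ∈ downZ (some e), P o) ↔ ((∀ d ∈ down e, P (some d)) ∧ (dead e → P none)) := by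
  constructor
  · intro h
    refine ⟨fun d hd => h (some d) ((hdZs e (some d)).2 (Or.inl ⟨d, hd, rfl⟩)), fun he => h none ((hdZs e none).2 (Or.inr ⟨rfl, he⟩))⟩
  · rintro ⟨h1, h2⟩ o ho
    rcases (hdZs e o).1 ho with ⟨d, hd, rfl⟩ | ⟨rfl, he⟩
    · exact h1 d hd
    · exact h2 he

/-- **LEMMA Aᵤ (diagonal of an insertion).**  With `z` coloured like `u` in both colourings, the colouring order of `Q^{u,Y} ∪ₐ wedge` is the colouring order
of `Q ∪ₐ wedge` on the restrictions. [this work] -/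
theorem diag_iff_ins (down : E → Finset E) (u : E) (hu : ∀ d, d ∉ down u) (dead : E → Prop) (hdu : ∀ e, dead e → u ∈ down e)
    (downZ : Option E → Finset (Option E)) (hdZn : ∀ o, o ∈ downZ none ↔ o = some u)
    (hdZs : ∀ e o, o ∈ downZ (some e) ↔ (∃ d ∈ down e, o = some d) ∨ (o = none ∧ dead e))
    (leT : (E → Bool) → (E → Bool) → Prop)
    (hleT : ∀ s t, leT s t ↔
      ((∀ e, (t e = true ∧ ∀ d ∈ down e, t d = true) → (s e = true ∧ ∀ d ∈ down e, s d = true)) ∧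
       (∀ e, (s e = false ∧ ∀ d ∈ down e, s d = false) → (t e = false ∧ ∀ d ∈ down e, t d = false)) ∧
       (∀ e, s e = true → t e = false → ((∀ d ∈ down e, s d = true) ∧ (∀ d ∈ down e, t d = false)))))
    (leZ : (Option E → Bool) → (Option E → Bool) → Prop)
    (hleZ : ∀ s t, leZ s t ↔
      ((∀ o, (t o = true ∧ ∀ d ∈ downZ o, t d = true) → (s o = true ∧ ∀ d ∈ downZ o, s d = true)) ∧
       (∀ o, (s o = false ∧ ∀ d ∈ downZ o, s d = false) → (t o = false ∧ ∀ d ∈ downZ o, t d = false)) ∧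
       (∀ o, s o = true → t o = false → ((∀ d ∈ downZ o, s d = true) ∧ (∀ d ∈ downZ o, t d = false)))))
    (s s' : E → Bool) (t t' : Option E → Bool) (hts : ∀ e, t (some e) = s e) (hts' : ∀ e, t' (some e) = s' e)
    (htn : t none = s u) (htn' : t' none = s' u) :
    leZ t t' ↔ leT s s' := by
  have vac : ∀ (r : E → Bool) (b : Bool), (∀ d ∈ down u, r d = b) := fun r b d hd => (hu d hd).elim
  have HS := forall_downZ_some_ins down dead downZ hdZs
  have HN := AntitheticHat.forall_downZ_none downZ u hdZn
  -- the extra member `z ≡ u` of a dead down-set carries no information on the diagonal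
  have red : ∀ (r : E → Bool) (rz : Option E → Bool) (b : Bool), rz none = r u →
      ∀ e, ((∀ d ∈ down e, r d = b) ∧ (dead e → rz none = b)) ↔ (∀ d ∈ down e, r d = b) := by
    intro r rz b hrn e
    constructor
    · rintro ⟨h1, -⟩; exact h1
    · intro h; exact ⟨h, fun he => by rw [hrn]; exact h u (hdu e he)⟩
  rw [hleT, hleZ]
  constructor
  · rintro ⟨h1, h2, h3⟩
    refine ⟨fun e => ?_, fun e => ?_, fun e => ?_⟩
    · have h := h1 (some e); simp only [HS, red s t true htn, red s' t' true htn', hts, hts'] at h; exact h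
    · have h := h2 (some e); simp only [HS, red s t false htn, red s' t' false htn', hts, hts'] at h; exact h
    · have h := h3 (some e); simp only [HS, red s t true htn, red s' t' false htn', hts, hts'] at h; exact h
  · rintro ⟨h1, h2, h3⟩
    refine ⟨fun o => ?_, fun o => ?_, fun o => ?_⟩
    · cases o with
      | none =>
        simp only [HN, htn, htn', hts, hts']
        rintro ⟨ha, -⟩
        exact ⟨(h1 u ⟨ha, vac s' true⟩).1, (h1 u ⟨ha, vac s' true⟩).1⟩
      | some e => simp only [HS, red s t true htn, red s' t' true htn', hts, hts']; exact h1 e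
    · cases o with
      | none =>
        simp only [HN, htn, htn', hts, hts']
        rintro ⟨ha, -⟩
        exact ⟨(h2 u ⟨ha, vac s false⟩).1, (h2 u ⟨ha, vac s false⟩).1⟩
      | some e => simp only [HS, red s t false htn, red s' t' false htn', hts, hts']; exact h2 e
    · cases o with
      | none =>
        simp only [HN, htn, htn', hts, hts']
        intro ha hb
        exact ⟨ha, hb⟩
      | some e => simp only [HS, red s t true htn, red s' t' false htn', hts, hts']; exact h3 e

set_option maxHeartbeats 400000 in
/-- **LEMMA Dᵤ (antidiagonal of an insertion, order part).**  With `z` coloured unlike `u` in both colourings, `leZ t t′` holds iff (a) the three order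
conditions hold at every LIVE element (`¬ dead e`; their down-sets are live) for the restrictions to `Q ∪ₐ wedge`, and (b) every DEAD element that is red in `t`
is red in `t′` — i.e. the antidiagonal is ordered as `T(Q∖↑Y) × (blue<red)^{↑Y}`. [this work] -/
theorem off_iff_ins (down : E → Finset E) (u : E) (hu : ∀ d, d ∉ down u) (dead : E → Prop) (hdu : ∀ e, dead e → u ∈ down e)
    (downZ : Option E → Finset (Option E)) (hdZn : ∀ o, o ∈ downZ none ↔ o = some u)
    (hdZs : ∀ e o, o ∈ downZ (some e) ↔ (∃ d ∈ down e, o = some d) ∨ (o = none ∧ dead e))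
    (leZ : (Option E → Bool) → (Option E → Bool) → Prop)
    (hleZ : ∀ s t, leZ s t ↔
      ((∀ o, (t o = true ∧ ∀ d ∈ downZ o, t d = true) → (s o = true ∧ ∀ d ∈ downZ o, s d = true)) ∧
       (∀ o, (s o = false ∧ ∀ d ∈ downZ o, s d = false) → (t o = false ∧ ∀ d ∈ downZ o, t d = false)) ∧
       (∀ o, s o = true → t o = false → ((∀ d ∈ downZ o, s d = true) ∧ (∀ d ∈ downZ o, t d = false)))))
    (s s' : E → Bool) (t t' : Option E → Bool) (hts : ∀ e, t (some e) = s e) (hts' : ∀ e, t' (some e) = s' e)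
    (htn : t none = !(s u)) (htn' : t' none = !(s' u)) :
    leZ t t' ↔
      (((∀ e, ¬ dead e → (s' e = true ∧ ∀ d ∈ down e, s' d = true) → (s e = true ∧ ∀ d ∈ down e, s d = true)) ∧
        (∀ e, ¬ dead e → (s e = false ∧ ∀ d ∈ down e, s d = false) → (s' e = false ∧ ∀ d ∈ down e, s' d = false)) ∧
        (∀ e, ¬ dead e → s e = true → s' e = false → ((∀ d ∈ down e, s d = true) ∧ (∀ d ∈ down e, s' d = false)))) ∧
       (∀ e, dead e → s e = true → s' e = true)) := by
  have vac : ∀ (r : E → Bool) (b : Bool), (∀ d ∈ down u, r d = b) := fun r b d hd => (hu d hd).elim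
  have hnu : ¬ dead u := fun h => hu u (hdu u h)
  have HS := forall_downZ_some_ins down dead downZ hdZs
  have HN := AntitheticHat.forall_downZ_none downZ u hdZn
  -- on the antidiagonal a dead down-set is never monochromatic (it contains `u` and `z ≢ u`)
  have nomono : ∀ (r : E → Bool) (rz : Option E → Bool) (b : Bool), (∀ e, rz (some e) = r e) → rz none = !(r u) →
      ∀ e, dead e → ¬ ((∀ d ∈ down e, rz (some d) = b) ∧ (dead e → rz none = b)) := by
    intro r rz b hrs hrn e he ⟨h1, h2⟩
    have a1 := h1 u (hdu e he); rw [hrs] at a1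
    have a2 := h2 he; rw [hrn, a1] at a2
    cases b <;> simp at a2
  -- at a live element the extra member is absent
  have live : ∀ (r : E → Bool) (rz : Option E → Bool) (b : Bool),
      ∀ e, ¬ dead e → (((∀ d ∈ down e, r d = b) ∧ (dead e → rz none = b)) ↔ (∀ d ∈ down e, r d = b)) := by
    intro r rz b e he
    constructor
    · rintro ⟨h1, -⟩; exact h1
    · intro h; exact ⟨h, fun he' => (he he').elim⟩
  rw [hleZ]
  constructor
  · rintro ⟨h1, h2, h3⟩
    refine ⟨⟨fun e he => ?_, fun e he => ?_, fun e he => ?_⟩, fun e he hse => ?_⟩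
    · have h := h1 (some e)
      simp only [HS, live s t true e he, live s' t' true e he, hts, hts'] at h; exact h
    · have h := h2 (some e)
      simp only [HS, live s t false e he, live s' t' false e he, hts, hts'] at h; exact h
    · have h := h3 (some e)
      simp only [HS, live s t true e he, live s' t' false e he, hts, hts'] at h; exact h
    · -- a dead element cannot turn red → blue
      by_contra hne
      have hs'e : s' e = false := by cases h' : s' e <;> simp_all
      have h := h3 (some e)
      rw [hts, hts'] at h
      have hh := (h hse hs'e).1
      rw [HS] at hh
      exact nomono s t true hts htn e he hh
  · rintro ⟨⟨h1, h2, h3⟩, hd⟩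
    refine ⟨fun o => ?_, fun o => ?_, fun o => ?_⟩
    · cases o with
      | none =>
        simp only [HN, htn, htn', hts, hts']
        rintro ⟨ha, hb⟩; rw [hb] at ha; exact absurd ha (by decide)
      | some e =>
        by_cases he : dead e
        · rintro ⟨-, hb⟩; rw [HS] at hb; exact (nomono s' t' true hts' htn' e he hb).elim
        · simp only [HS, live s t true e he, live s' t' true e he, hts, hts']; exact h1 e he
    · cases o with
      | none =>
        simp only [HN, htn, htn', hts, hts']
        rintro ⟨ha, hb⟩; rw [hb] at ha; exact absurd ha (by decide)
      | some e =>
        by_cases he : dead e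
        · rintro ⟨-, hb⟩; rw [HS] at hb; exact (nomono s t false hts htn e he hb).elim
        · simp only [HS, live s t false e he, live s' t' false e he, hts, hts']; exact h2 e he
    · cases o with
      | none =>
        simp only [HN, htn, htn', hts, hts']
        intro ha hb
        have hsu : s u = false := by simpa using ha
        have hs'u : s' u = true := by simpa using hb
        have h22 := (h2 u hnu ⟨hsu, vac s false⟩).1
        rw [h22] at hs'u; exact absurd hs'u (by decide)
      | some e =>
        by_cases he : dead e
        · intro ha hb
          rw [hts] at ha; rw [hts'] at hb
          have := hd e he ha; rw [this] at hb; exact absurd hb (by decide)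
        · simp only [HS, live s t true e he, live s' t' false e he, hts, hts']; exact h3 e he

/-- **THEOREM S2ᵤ(i), conditional kernel form.**  For the insertion `Q^{u,Y}` (setting above; `ι′`, `κ` the wedge flips, `u ∉ {c′,x′}`): if `R_T ≥ m` on all
pairs of `leT`-up-sets of `TQ` and the rearrangement functional of the ANTIDIAGONAL `{z ≢ u}` (pairs of subsets of the antidiagonal that are up-closed inside it)
is `≥ 0`, then `R_Z ≥ m` on all pairs of `leZ`-up-sets.  The antidiagonal hypothesis is THEOREM R₀ for the product `T(Q∖↑Y) × (blue<red)^{↑Y}` of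
`off_iff_ins` (pencil + machine in FINDING-S2U-g55 §1b); everything else is kernel-checked here. [this work] -/
theorem insert_neutrality [Fintype E] [DecidableEq E] (down : E → Finset E) (u c x : E) (hu : ∀ d, d ∉ down u)
    (huc : u ≠ c) (hux : u ≠ x) (dead : E → Prop) (hdu : ∀ e, dead e → u ∈ down e)
    (downZ : Option E → Finset (Option E)) (hdZn : ∀ o, o ∈ downZ none ↔ o = some u)
    (hdZs : ∀ e o, o ∈ downZ (some e) ↔ (∃ d ∈ down e, o = some d) ∨ (o = none ∧ dead e))
    (leT : (E → Bool) → (E → Bool) → Prop)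
    (hleT : ∀ s t, leT s t ↔
      ((∀ e, (t e = true ∧ ∀ d ∈ down e, t d = true) → (s e = true ∧ ∀ d ∈ down e, s d = true)) ∧
       (∀ e, (s e = false ∧ ∀ d ∈ down e, s d = false) → (t e = false ∧ ∀ d ∈ down e, t d = false)) ∧
       (∀ e, s e = true → t e = false → ((∀ d ∈ down e, s d = true) ∧ (∀ d ∈ down e, t d = false)))))
    (leZ : (Option E → Bool) → (Option E → Bool) → Prop)
    (hleZ : ∀ s t, leZ s t ↔
      ((∀ o, (t o = true ∧ ∀ d ∈ downZ o, t d = true) → (s o = true ∧ ∀ d ∈ downZ o, s d = true)) ∧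
       (∀ o, (s o = false ∧ ∀ d ∈ downZ o, s d = false) → (t o = false ∧ ∀ d ∈ downZ o, t d = false)) ∧
       (∀ o, s o = true → t o = false → ((∀ d ∈ downZ o, s d = true) ∧ (∀ d ∈ downZ o, t d = false)))))
    (ι' : (E → Bool) → (E → Bool))
    (hι : ∀ s e, ι' s e = (if s c = s x then !(s e) else (if e = c ∨ e = x then !(s e) else s e)))
    (κ : (Option E → Bool) → (Option E → Bool))
    (hκ : ∀ t o, κ t o = (if t (some c) = t (some x) then !(t o) else (if o = some c ∨ o = some x then !(t o) else t o)))
    (m : ℤ)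
    (hR : ∀ A B : Finset (E → Bool), (∀ s s', leT s s' → s ∈ A → s' ∈ A) → (∀ s s', leT s s' → s ∈ B → s' ∈ B) →
      m ≤ ((A ∩ B).card : ℤ) - ((A.filter (fun s => ι' s ∈ B)).card : ℤ))
    (hoff : ∀ A B : Finset (Option E → Bool), (∀ t ∈ A, t none = !(t (some u))) → (∀ t ∈ B, t none = !(t (some u))) →
      (∀ t t', t' none = !(t' (some u)) → leZ t t' → t ∈ A → t' ∈ A) → (∀ t t', t' none = !(t' (some u)) → leZ t t' → t ∈ B → t' ∈ B) →
      (0 : ℤ) ≤ ((A ∩ B).card : ℤ) - ((A.filter (fun z => κ z ∈ B)).card : ℤ))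
    (AA BB : Finset (Option E → Bool)) (hAA : ∀ t t', leZ t t' → t ∈ AA → t' ∈ AA) (hBB : ∀ t t', leZ t t' → t ∈ BB → t' ∈ BB) :
    m ≤ ((AA ∩ BB).card : ℤ) - ((AA.filter (fun z => κ z ∈ BB)).card : ℤ) := by
  classical
  set δ : (E → Bool) → (Option E → Bool) := fun s o => Option.elim o (s u) s
  set D : Finset (Option E → Bool) := Finset.univ.filter (fun t => t none = t (some u))
  have δsome : ∀ s e, δ s (some e) = s e := fun s e => rfl
  have δnone : ∀ s, δ s none = s u := fun s => rfl
  have hDmem : ∀ t, t ∈ D ↔ t none = t (some u) := fun t => by simp [D]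
  have hDc : ∀ t, t ∉ D ↔ t none = !(t (some u)) := by
    intro t; rw [hDmem]; cases t none <;> cases t (some u) <;> decide
  have hδ : Function.Injective δ := by
    intro s s' h; funext e; have h1 := congrFun h (some e); rwa [δsome, δsome] at h1
  have h1 : ((none : Option E) = some c ∨ (none : Option E) = some x) ↔ False := by simp
  have h2 : (u = c ∨ u = x) ↔ False := by simp [huc, hux]
  have hκδ : ∀ s, κ (δ s) = δ (ι' s) := by
    intro s; funext o
    cases o with
    | none =>
      show κ (δ s) none = ι' s u
      rw [hκ, hι]; simp only [δsome, δnone, h1, h2, if_false]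
    | some e =>
      show κ (δ s) (some e) = ι' s e
      rw [hκ, hι]; simp only [δsome, Option.some.injEq]
  have hD : ∀ t, t ∈ D ↔ κ t ∈ D := by
    intro t; rw [hDmem, hDmem, hκ, hκ]
    have h3 : ¬ (some u = some c ∨ some u = some x) := by simp [huc, hux]
    simp only [h1, h3, if_false]
    split_ifs
    · constructor
      · intro h; rw [h]
      · intro h; exact Bool.not_inj h
    · exact Iff.rfl
  have hDδ : ∀ s, δ s ∈ D := fun s => by rw [hDmem, δnone, δsome]
  have hDsurj : ∀ t ∈ D, ∃ s, δ s = t := by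
    intro t ht; refine ⟨fun e => t (some e), ?_⟩; funext o
    cases o with
    | none => show t (some u) = t none; exact ((hDmem t).1 ht).symm
    | some e => rfl
  have DI := fun s s' => diag_iff_ins down u hu dead hdu downZ hdZn hdZs leT hleT leZ hleZ s s' (δ s) (δ s') (δsome s) (δsome s') (δnone s) (δnone s')
  have upA : ∀ s s', leT s s' → s ∈ univ.filter (fun s => δ s ∈ AA) → s' ∈ univ.filter (fun s => δ s ∈ AA) := by
    intro s s' hss' hs; simp only [Finset.mem_filter, Finset.mem_univ, true_and] at hs ⊢
    exact hAA _ _ ((DI s s').2 hss') hs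
  have upB : ∀ s s', leT s s' → s ∈ univ.filter (fun s => δ s ∈ BB) → s' ∈ univ.filter (fun s => δ s ∈ BB) := by
    intro s s' hss' hs; simp only [Finset.mem_filter, Finset.mem_univ, true_and] at hs ⊢
    exact hBB _ _ ((DI s s').2 hss') hs
  -- the antidiagonal parts are up-closed inside the antidiagonal
  have offA : ∀ t ∈ AA \ D, t none = !(t (some u)) := fun t ht => (hDc t).1 (Finset.mem_sdiff.1 ht).2
  have offB : ∀ t ∈ BB \ D, t none = !(t (some u)) := fun t ht => (hDc t).1 (Finset.mem_sdiff.1 ht).2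
  have upA' : ∀ t t', t' none = !(t' (some u)) → leZ t t' → t ∈ AA \ D → t' ∈ AA \ D := by
    intro t t' ht' hle ht; rw [Finset.mem_sdiff] at ht ⊢; exact ⟨hAA _ _ hle ht.1, (hDc t').2 ht'⟩
  have upB' : ∀ t t', t' none = !(t' (some u)) → leZ t t' → t ∈ BB \ D → t' ∈ BB \ D := by
    intro t t' ht' hle ht; rw [Finset.mem_sdiff] at ht ⊢; exact ⟨hBB _ _ hle ht.1, (hDc t').2 ht'⟩
  have hoff' := hoff (AA \ D) (BB \ D) offA offB upA' upB'
  exact AntitheticStalkSplit.neutrality_skeleton δ hδ ι' κ hκδ D hD hDδ hDsurj m AA BB (hR _ _ upA upB) hoff'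

end AntitheticInsertion

end Summit.CriticalPhenomena.PercolationContinuityZ3.Theorems
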